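import Summits.QuantumFields.YangMills.Theses.GronwallGap
import Literature.RepresentationTheory.CompactGroups.UnitaryTrick
import Summits.QuantumFields.YangMills.Theorems.GronwallGapAnalyticDetourStubExpPosSemidef
import Summits.QuantumFields.YangMills.Theorems.GronwallGapAnalyticDetourStubWilsonSegmentAdm
import Summits.QuantumFields.YangMills.Theorems.GronwallGapAnalyticDetourStubNearHaarAnalytic

/-!
# Crux `AnalyticDetour` (stmt-QuantumFields-8801), line `registered`:
# the strong-coupling WINDOW is internally connected by admissible analytic weight paths

Route `GronwallGap`, sub-problem `YangMills`.  This file proves the birth skeleton's window stub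
`stub_strongCouplingWindow` (planner `Lines/birth.lean`; the route header's "GeneralWeightOS78"
child of the crux) as a THEOREM: for every compact simple Lie group `G` (Borel σ-algebra) and
every faithful continuous unitary lattice representation `r` there is `β₁ > 0` such that any two
Wilson points `βa, βb ∈ (0, β₁)` are joined by an ADMISSIBLE single-plaquette weight path
(`Adm`: each weight continuous, positive, a class function, symmetric under inversion, of positive
type, and `s ↦ log w_s` Lipschitz in sup norm) whose torus pressure is Gateaux-analytic in every
continuous class-function direction at every parameter (`AnP`: the thermodynamic limits
`p(t) = lim_L (L+1)⁻⁴ log Z_{L+1}(w_s e^{tφ})` exist for all real `t` and `p` is real-analytic at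
`0`), from `exp(βa Re tr r)` to `exp(βb Re tr r)`.

The witness is the straight Wilson segment `w_s = exp(((1-s)βa + sβb) Re tr r.ρ)` with
`β₁ := η/(N+1)`, where `η` is the radius of `stub_nearHaarAnalytic` (Gateaux-analytic pressure of
every continuous positive weight `v` with `|log v| ≤ η` on a compact metrisable group: the
general-weight Friedli–Velenik thermodynamic limit `tendsto_torusPressure_of_continuous_pos`, the
Kotecký–Preiss logarithm in a complex class direction
`exists_differentiableOn_torusPressure_classDirection`, and Vitali's theorem), since
`|((1-s)βa + sβb) Re tr r.ρ g| ≤ β₁ N ≤ η` (`abs_re_trace_le_card`); admissibility of the segment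
is `stub_wilsonSegmentAdm` (Gram kernel `Re tr(ρ(x)ᴴρ(y))`, `IsPosDefKernel.exp`); `G` is compact
metrisable because the faithful representation `r.ρ` is a closed embedding into matrices.

With this theorem the crux `AnalyticDetour` is reduced (by concatenation of paths, the birth
skeleton's sorry-free `AnalyticDetour_of`) to its open core `stub_anchoredDetour` alone.
No named facts; no definitions.
-/

noncomputable section

namespace Summit.QuantumFields.YangMills.Theorems

/-- **The strong-coupling window of route `GronwallGap`'s crux `AnalyticDetour` (birth stub
`stub_strongCouplingWindow`, now a theorem).**  For every compact simple Lie group `G` and every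
lattice representation `r` there is `β₁ > 0` such that any two Wilson points `βa, βb ∈ (0, β₁)` are
joined by an admissible weight path with Gateaux-analytic torus pressure at every parameter, from
`exp(βa Re tr r)` to `exp(βb Re tr r)` — the Wilson segment, `β₁ := η/(N+1)` with `η` from
`stub_nearHaarAnalytic`. -/
theorem stub_strongCouplingWindow :
    ∀ (G : Type) [Group G] [TopologicalSpace G] [IsTopologicalGroup G] [CompactSpace G], Literature.MathematicalPhysics.QuantumFieldTheory.IsCompactSimpleLieGroup G → letI : MeasurableSpace G := borel G; haveI : BorelSpace G := ⟨rfl⟩; let Pseq : (G → ℝ) → ℕ → ℝ := fun v L => (((L + 1 : ℕ) : ℝ) ^ 4)⁻¹ * Real.log (((MeasureTheory.Measure.pi fun _ : Literature.MathematicalPhysics.QuantumFieldTheory.Edge 4 (L + 1) => Literature.MathematicalPhysics.QuantumFieldTheory.haarProbability G).withDensity (fun U : Literature.MathematicalPhysics.QuantumFieldTheory.GaugeConfig 4 (L + 1) G => ENNReal.ofReal (Literature.MathematicalPhysics.QuantumLattice.groupHeatKernelWeight (fun _ : ℝ => v) 0 U))) Set.univ).toReal; let AnP : (G → ℝ) →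 Prop := fun v => ∀ φ : G → ℝ, Continuous φ → (∀ g h : G, φ (h * g * h⁻¹) = φ g) → ∃ p : ℝ → ℝ, (∀ t : ℝ, Filter.Tendsto (fun L : ℕ => Pseq (fun g => v g * Real.exp (t * φ g)) L) Filter.atTop (nhds (p t))) ∧ AnalyticAt ℝ p 0; let Adm : (ℝ → G → ℝ) → Prop := fun w => (∀ s ∈ Set.Icc (0 : ℝ) 1, Continuous (w s) ∧ (∀ g : G, 0 < w s g) ∧ (∀ g h : G, w s (h * g * h⁻¹) = w s g) ∧ (∀ g : G, w s g⁻¹ = w s g) ∧ (∀ (n : ℕ) (x : Fin n → G) (c : Fin n → ℂ), 0 ≤ (∑ i, ∑ j, (starRingEnd ℂ) (c i) * c j * ((w s ((x i)⁻¹ * x j) : ℝ) : ℂ)).re)) ∧ ∃ Λ : ℝ, ∀ s ∈ Set.Icc (0 : ℝ) 1, ∀ s' ∈ Set.Icc (0 : ℝ) 1, ∀ g : G, |Real.log (w s g) - Real.log (w s' g)| ≤ Λ * |s - s'|; ∀ r : Literature.MathematicalPhysics.QuantumFieldTheory.LatticeRep G, ∃ β₁ : ℝ, 0 < β₁ ∧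 ∀ βa ∈ Set.Ioo (0 : ℝ) β₁, ∀ βb ∈ Set.Ioo (0 : ℝ) β₁, ∃ w : ℝ → G → ℝ, Adm w ∧ (∀ s ∈ Set.Icc (0 : ℝ) 1, AnP (w s)) ∧ w 0 = (fun g => Real.exp (βa * (r.ρ g).trace.re)) ∧ w 1 = (fun g => Real.exp (βb * (r.ρ g).trace.re)) := by
  intro G i1 i2 i3 i4 hG Pseq AnP Adm r
  letI : MeasurableSpace G := borel G
  haveI : BorelSpace G := ⟨rfl⟩
  -- `G` is compact metrisable: the faithful representation is a closed embedding into matrices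
  have hemb : Topology.IsClosedEmbedding r.ρ := r.continuous.isClosedEmbedding r.injective
  haveI : T2Space G := hemb.isEmbedding.t2Space
  haveI : SecondCountableTopology (Matrix (Fin r.N) (Fin r.N) ℂ) :=
    inferInstanceAs (SecondCountableTopology (Fin r.N → Fin r.N → ℂ))
  haveI : SecondCountableTopology G := hemb.isEmbedding.secondCountableTopology
  obtain ⟨η, hη, hAn⟩ := stub_nearHaarAnalytic G
  have hAdm := stub_wilsonSegmentAdm stub_expPosSemidef G hG r
  have hN : ∀ g : G, |(r.ρ g).trace.re| ≤ r.N := fun g => by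
    simpa using Literature.RepresentationTheory.CompactGroups.CompactGroup.abs_re_trace_le_card
      r.ρ r.continuous g
  have hN0 : (0 : ℝ) ≤ r.N := Nat.cast_nonneg _
  set β₁ : ℝ := η / (r.N + 1) with hβ₁
  have hβ₁pos : 0 < β₁ := by positivity
  have hβ₁N : β₁ * r.N ≤ η := by
    rw [hβ₁, div_mul_eq_mul_div, div_le_iff₀ (by positivity)]
    nlinarith
  refine ⟨β₁, hβ₁pos, fun βa hβa βb hβb => ?_⟩
  obtain ⟨hβa0, hβa1⟩ := hβa
  obtain ⟨hβb0, hβb1⟩ := hβb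
  have hTc : Continuous fun g : G => (r.ρ g).trace.re :=
    Complex.continuous_re.comp r.continuous.matrix_trace
  refine ⟨fun s g => Real.exp (((1 - s) * βa + s * βb) * (r.ρ g).trace.re),
    hAdm βa βb hβa0.le hβb0.le, ?_, ?_, ?_⟩
  · intro s hs
    obtain ⟨hs0, hs1⟩ := hs
    refine hAn _ (Real.continuous_exp.comp (continuous_const.mul hTc)) (fun g => Real.exp_pos _)
      fun g => ?_
    rw [Real.log_exp, abs_mul]
    have hc0 : 0 ≤ (1 - s) * βa + s * βb := by nlinarith
    have hc1 : (1 - s) * βa + s * βb ≤ β₁ := by nlinarith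
    rw [abs_of_nonneg hc0]
    calc ((1 - s) * βa + s * βb) * |(r.ρ g).trace.re| ≤ β₁ * r.N :=
          mul_le_mul hc1 (hN g) (abs_nonneg _) hβ₁pos.le
      _ ≤ η := hβ₁N
  · funext g
    norm_num
  · funext g
    norm_num

end Summit.QuantumFields.YangMills.Theorems

end
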